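import Mathlib
import HarnessLib
import HarnessLib.Audit
import Summits.HodgeConjecture.Statement
import Literature.AlgebraicGeometry.HodgeTheory.GysinFormalism
import Literature.AlgebraicTopology.SingularHomology.CupProduct
import HarnessLib.Audit.Status.Attr

/-!
Route: OG6CharacterSectors

# Route OG6CharacterSectors — character projectors of the rigid group (Z/2)^8 cut HC(OG6-type) into
an invariant sector, even strings and chiral middle planes

Route OG6CharacterSectors realises idea card og6-theta-characteristics-chiral-cycles (spine); it is
the D-0027 §2.1-conforming
re-filing of route-HodgeConjecture-OG6ThetaCharacters (retired 2026-08-15 not-a-thesis: its assembly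
stopped at `Target`).
It suffices to show X = `Target`:
the Hodge conjecture `HodgeConjectureFor 6 X` for every OG6 FRAME — a smooth projective sixfold X
over ℂ with a Hodge model,
b₁ = b₃ = b₅ = 0, b₂ = 8, b₄ = 199, b₆ = 1504, H^(2,0) = ℂσ with σ³ ≠ 0 in H⁶, and a faithful action
g : (Z/2)^8 → Aut(X) that is
trivial on H²(X(ℂ);ℂ) — which is ENDOMORPHISM-GENERIC (E = Q: every rational Hodge endomorphism of
H² acts on σ by a rational scalar).
By Mongardi–Wandel (arXiv:1411.0759 Thm 4.2: Aut₀ = ker(Aut X → O(H²)) ≅ (Z/2)^8 for every OG6-type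
manifold), Hassett–Tschinkel
deformation invariance (arXiv:1004.0046 Thm 2.1) and the MRS Betti numbers (arXiv:1603.06731), every
projective manifold of OG6 type is
such a frame (informal support item FrameOfOG6Type; the deformation type itself is a definition
request), so X is "HC for
endomorphism-generic projective OG6-type manifolds" — a locally complete hyper-Kähler family on
which HC is open in general (for the
other sporadic-group sixfolds, Kum³-type, it is a theorem: arXiv:2308.02267; for OG6 it is known
only on the singular-OG6 divisor
arXiv:2504.13607 and the modular locus arXiv:2203.16257 Cor 2).
X splits along the algebraic character projectors e_a = 2⁻⁸ Σ_b (−1)^(a·b) g_b^* (ℚ-combinations of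
graphs of automorphisms) into
X₀ = InvariantSector (a = 0, all degrees), X_even = EvenCharacterStrings (characters occurring on
H⁴: degrees 4, 6, 8) and
X_odd = ChiralThreefolds (characters absent from H⁴: degree 6); FourierInversion (Σ_a e_a = id),
OuterDegrees and OddCharactersOffMiddle
glue them into X, and the explicitly NOT-claimed remainder SummitBeyondOG6Frames (X →
HodgeConjecture) carries the assembly to the
sub-problem statement; the deciding theorem `closes` (glue.lean) is proved sorry-free.
Lean: `∀ (X : Literature.AlgebraicGeometry.Motives.SchemeOver ℂ) (g : (Fin 8 → ZMod 2) → (X ⟶ X)),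
(Literature.AlgebraicGeometry.Motives.IsSmoothProjective 6 X ∧ Nonempty
(Literature.AlgebraicGeometry.HodgeTheory.HodgeModel 6 X) ∧ (Subsingleton
(Literature.AlgebraicGeometry.HodgeTheory.complexBetti X 1) ∧ Subsingleton
(Literature.AlgebraicGeometry.HodgeTheory.complexBetti X 3) ∧ Subsingleton
(Literature.AlgebraicGeometry.HodgeTheory.complexBetti X 5)) ∧ (Module.finrank ℂ
(Literature.AlgebraicGeometry.HodgeTheory.complexBetti X 2) = 8 ∧ Module.finrank ℂ
(Literature.AlgebraicGeometry.HodgeTheory.complexBetti X 4) = 199 ∧ Module.finrank ℂ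
(Literature.AlgebraicGeometry.HodgeTheory.complexBetti X 6) = 1504) ∧ (∃ σ :
Literature.AlgebraicGeometry.HodgeTheory.complexBetti X 2,
Literature.AlgebraicGeometry.HodgeTheory.IsOfHodgeType 6 X 2 2 0 σ ∧
Literature.AlgebraicTopology.SingularHomology.cupProduct (show 2 + 4 = 6 from rfl) σ
(Literature.AlgebraicTopology.SingularHomology.cupProduct (show 2 + 2 = 4 from rfl) σ σ) ≠ 0 ∧ ∀ τ :
Literature.AlgebraicGeometry.HodgeTheory.complexBetti X 2,
Literature.AlgebraicGeometry.HodgeTheory.IsOfHodgeType 6 X 2 2 0 τ → ∃ t : ℂ, τ = t • σ) ∧ (g 0 =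
CategoryTheory.CategoryStruct.id X ∧ (∀ a b : (Fin 8 → ZMod 2), g (a + b) =
CategoryTheory.CategoryStruct.comp (g a) (g b)) ∧ (∀ a : (Fin 8 → ZMod 2), a ≠ 0 → g a ≠
CategoryTheory.CategoryStruct.id X) ∧ (∀ (a : (Fin 8 → ZMod 2)) (c :
Literature.AlgebraicGeometry.HodgeTheory.complexBetti X 2),
Literature.AlgebraicGeometry.HodgeTheory.complexBetti.map (g a) 2 c = c))) → (∀ ψ :
Literature.AlgebraicGeometry.HodgeTheory.complexBetti X 2 →ₗ[ℂ]
Literature.AlgebraicGeometry.HodgeTheory.complexBetti X 2, (∀ c,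
Literature.AlgebraicGeometry.HodgeTheory.IsRationalClass c →
Literature.AlgebraicGeometry.HodgeTheory.IsRationalClass (ψ c)) → (∀ (p q : ℕ) (c :
Literature.AlgebraicGeometry.HodgeTheory.complexBetti X 2),
Literature.AlgebraicGeometry.HodgeTheory.IsOfHodgeType 6 X 2 p q c →
Literature.AlgebraicGeometry.HodgeTheory.IsOfHodgeType 6 X 2 p q (ψ c)) → ∃ r : ℚ, ∀ σ :
Literature.AlgebraicGeometry.HodgeTheory.complexBetti X 2,
Literature.AlgebraicGeometry.HodgeTheory.IsOfHodgeType 6 X 2 2 0 σ → ψ σ = (r : ℂ) • σ) →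
Literature.AlgebraicGeometry.HodgeTheory.HodgeConjectureFor 6 X`

## Assembly
Pure logic plus `Submodule.sum_mem` (the deciding theorem `closes` in glue.lean, PROVED sorry-free,
axioms
propext/Classical.choice/Quot.sound, lean check rc 0, 2026-08-15): given an endomorphism-generic
frame and a rational (p,p)-class c,
FourierInversion rewrites c = Σ_a e_a c; the a = 0 term is algebraic by InvariantSector; for a ≠ 0
and p ∈ {2,3,4} split on whether
the character of a occurs on H⁴: if not, p = 2 gives e_a c = 0, p = 3 is ChiralThreefolds and p = 4
is OddCharactersOffMiddle; if it
does, EvenCharacterStrings; p ∉ {2,3,4} is OuterDegrees; the Hodge-model conjunct of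
`HodgeConjectureFor` is a frame hypothesis. This
gives X = Target (theorem `target_of_sectors` of the planner's Sketch.lean), and the NOT-claimed
remainder SummitBeyondOG6Frames takes X
to `HodgeConjecture`. The route's mathematical content is X; the last arrow is bookkeeping required
by D-0027 §2.1 and says so.

Rationale: WHY THIS LINE. Mechanism (card og6-theta-characteristics-chiral-cycles): the rigid group G = Aut₀(X)
≅ (Z/2)^8 of an OG6-type manifold (arXiv:1411.0759
Thm 4.2) deforms with X (arXiv:1004.0046 Thm 2.1), commutes with the LLV algebra so(4,6)
(arXiv:1906.03432 Thm 52: H* = V_(3) ⊕ V_(1,1,1)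
⊕ 135 V ⊕ 240 ℝ), and its 256 character projectors are FREE algebraic self-correspondences; they cut
every Hodge class into pieces that
are separately Hodge, so HC(X) is literally the conjunction of sector statements, and in the
non-trivial sectors — which carry the 135
canonical classes of H⁴ and the 240 canonical middle classes (type (3,3), Λ_h- and L_h-trivial,
never effective by Verbitsky
doi:10.1007/bf01928217) — HC becomes a SPANNING statement "some cycle Z has e_a[Z] ≠ 0", certifiable
by intersection numbers on one model
because fixed loci and G-orbits of cycles deform with X. Imported from finite-group representation
theory (character projectors, Lefschetz
trace bookkeeping: Σ_g χ(X^g) = 256·dim(H*)^G) and hyper-Kähler geometry (LLV decomposition,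
trianalytic parity, hyperholomorphic transport
arXiv:1805.11574 as fallback engine); the template is Floccari's proof of HC for Kum³-type
(arXiv:2308.02267: G = (Z/2)^5, invariant part
via the associated K3 surface, canonical classes via fixed fourfolds W_τ and the classes d_τ,α =
ι_*(divisors), Prop 6.1/6.5) and
Hassett–Tschinkel's Kum² (arXiv:1004.0046), transplanted to OG6 where the published fixed-locus
record (arXiv:1411.0759 Props 5.1, 5.3,
5.7: 16 K3 / 2 K3 / 16 points) is provably INCONSISTENT with Lefschetz (Σ_(g≠1) χ(X^g) = 16560 <
51840 = 256·210 − 1920 forced by the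
G-invariant 210-dimensional Verbitsky subalgebra), so the decisive census (do fixed FOURFOLDS
exist?) is genuinely open. No other route
of this summit touches OG6 (EvenB2Twistor, LimitExtension mention it only as out of scope; the
predecessor OG6ThetaCharacters is this
route's own retired first filing); negatives index empty.

RANKED CRUXES. #0 Target (target) — X: for every OG6 frame (X, g) as in § Thesis which is
endomorphism-generic (E = Q), HodgeConjectureFor 6 X. Equivalent, via the informal support item
FrameOfOG6Type, to HC for endomorphism-generic projective manifolds of OG6 type. (why it might fail:
False iff some endomorphism-generic projective OG6 frame carries a non-algebraic Hodge class
(motivated and absolute by arXiv:1904.11320, so ¬B would follow); HC(OG6) is known only on the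
singular-OG6 divisor (arXiv:2504.13607) and modular locus (arXiv:2203.16257).) [arXiv:2504.13607,
arXiv:2203.16257, arXiv:2308.02267, arXiv:1411.0759, Deligne2000]
#2 ChiralThreefolds (crux) — CHIRAL MIDDLE PLANES (card C1): for every OG6 frame (X, g), every a ≠ 0
whose character does NOT occur on H⁴ (∀ c₄, e_a c₄ = 0 — the card's 120 "odd theta characteristics",
carrying the 240 canonical LLV-singlets two at a time) and every rational (3,3)-class c ∈ H⁶, the
projection e_a c = 2⁻⁸ Σ_b (−1)^(a·b) g_b^* c is algebraic. Equivalently: on every projective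
OG6-type X there are algebraic 3-cycles whose e_a-projections span the Hodge classes of e_a H⁶
(chiral threefolds); the Poincaré-dual H⁸ clause is the support item OddCharactersOffMiddle.
[difficulty: XL] (why it might fail: If no involution in G fixes a fourfold (arXiv:1411.0759 §5
records only K3s and points), no fixed-locus cycle reaches H⁶; these classes are never effective
(Verbitsky) nor reachable by L_h, Λ_h, so off the singular-OG6 divisor only untested G-equivariant
hyperholomorphic transport remains.) [arXiv:1906.03432, arXiv:1411.0759, arXiv:2308.02267,
arXiv:2504.13607, doi:10.1007/bf01928217, arXiv:1805.11574]
#3 EvenCharacterStrings (crux) — EVEN CHARACTER STRINGS (card C2): for every OG6 frame (X, g) and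
every a ≠ 0 whose character OCCURS on H⁴ (∃ c₄, e_a c₄ ≠ 0 — the card's 135 non-zero "even theta
characteristics", one canonical line u_a ∈ H⁴ each, with the V-string u_a·H² ⊂ H⁶ and u_a·h² ∈ H⁸),
the e_a-projections of rational (2,2)-, (3,3)- and (4,4)-classes are algebraic. Intended proof: e_a
H⁸ is spanned by e_a[S] for the fixed K3 surfaces S of the 30 pure involutions (arXiv:1411.0759
Props 5.1, 5.3; fixed loci deform with X), then invert L_h² (standard conjecture B for OG6-type in
degrees 4 ↔ 8) or use fixed fourfolds if the census finds them; H⁶ follows by cup with divisors.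
[difficulty: L] (why it might fail: Fixed K3 surfaces feed only H⁸; reaching the H⁴ lines needs a
Lefschetz inversion (standard conjecture B for OG6-type, open off the modular locus) or fixed
fourfolds; and the 16-K3 configurations of the 30 pure involutions may span only the characters of a
proper subgroup.) [arXiv:1411.0759, arXiv:1009.0413, arXiv:1906.03432, arXiv:2203.16257,
arXiv:1004.0046]
#4 InvariantSector (crux) — INVARIANT SECTOR (card "A₂-part" made honest): for every
endomorphism-generic OG6 frame (X, g) (E = Q) and every rational (p,p)-class c, the G-average e₀ c =
2⁻⁸ Σ_b g_b^* c is algebraic. By the card's character table (H*)^G = V_(3) ⊕ V_(1,1,1): for E = Q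
its Hodge classes are polynomials in NS(X) and the Beauville–Bogomolov class q^∨ (= c₂(X)/c if c₂
has no U₄-component) plus the V_(1,1,1)-classes h∧u₊∧u₋ (ρ ≥ 1), d∧d′ ∈ Λ²NS ⊂ H⁴, H⁸ (ρ ≥ 2), Λ³NS
(ρ ≥ 3) and det T ∈ Λ³T ⊂ H⁶ (ρ = 5). Natural engines: the associated K3^[3]-type double cover on
the singular-OG6 divisor (arXiv:2504.13607, arXiv:1603.06731), quotients X/H for H ≤ G (Floccari's
Y_K for Kum³, arXiv:2210.02948), deformation of these classes from the modular locus
(arXiv:2203.16257). [difficulty: L] (why it might fail: If the character table puts a trivial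
character inside the 135 V-copies or the 240 singlets this sector contains canonical exceptional
classes; even otherwise the V_(1,1,1) classes (h∧u₊∧u₋, d∧d′, det T for ρ = 5 — killed by every L_d
and Λ_d) have no known cycles off the singular-OG6 divisor.) [arXiv:1906.03432, arXiv:2203.16257,
arXiv:2504.13607, arXiv:2210.02948, arXiv:2308.02267]
#9 OuterDegrees (support) — BOOKKEEPING: for an OG6 frame, p ∉ {2,3,4} and a ≠ 0, the e_a-projection
of a rational (p,p)-class in H^(2p) is algebraic — indeed it vanishes: H⁰ and H² are G-trivial by
hypothesis (and algebraicClasses X 0 = ⊤ is proved), H¹⁰, H¹² by hard Lefschetz with a G-invariant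
ample class / Poincaré duality and naturality of cup product (`cupProduct_map`, proved), H^(2p) = 0
for p ≥ 7 (cohomological dimension of the 12-manifold X(ℂ)); needs the named facts hard Lefschetz /
top-degree vanishing for X. [difficulty: provable-now] [arXiv:1411.0759, Deligne2000]
#9 FourierInversion (support) — CHARACTER ORTHOGONALITY: for an OG6 frame, Σ_a e_a c = c on every
H^k — from g 0 = 𝟙, `complexBetti.map_id` (proved) and Σ_a (−1)^(a·b) = 256·[b = 0] on (Fin 8 → ZMod
2) (factorise over coordinates). Pure algebra. [difficulty: provable-now] [arXiv:1411.0759]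
#9 OddCharactersOffMiddle (support) — DUALITY BOOKKEEPING: for an OG6 frame, a ≠ 0 whose character
does not occur on H⁴, and a rational (4,4)-class c ∈ H⁸, e_a c is algebraic — indeed e_a annihilates
H⁸, because H⁸ ≅ (H⁴)^∨ G-equivariantly (Poincaré duality; automorphisms have degree 1) and the
characters of an elementary abelian 2-group are self-dual; needs the named Poincaré-duality facts
for X(ℂ) (or hard Lefschetz with a G-invariant ample class plus `cupProduct_map`). [difficulty:
provable-now] [arXiv:1411.0759, Deligne2000]
#9 SummitBeyondOG6Frames (support) — NOT CLAIMED BY THIS ROUTE — the remainder of the summit given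
X: `Target → HodgeConjecture`, i.e. the Hodge conjecture for every smooth projective complex variety
that is not an endomorphism-generic OG6 frame (all other dimensions and deformation types, the E ≠ Q
OG6 manifolds, abelian varieties, hypersurfaces, …), granted HC on the OG6 sector. Present only so
that the deciding theorem `closes` and the Assembly reach `HodgeConjecture` (D-0027 §2.1); it is the
frame statement "X → Statement" of the planner brief. Any route proving the summit outright
supersedes it. Do not staff. [difficulty: open-problem] [Deligne2000]

TWO-LAYER PLAN. Foreseen glued splits (filed only after the informal support item CharacterCensus
settles the character table and the fixed loci):
ChiralThreefolds ⇐ FixedFourfoldCycles (if some involutions fix HK fourfolds W: the classes e_a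
ι_*(Pic W), which stay analytic on every
deformation by Floccari's Lemma 6.4 argument, span e_a H⁶ for every odd a — a finite
intersection-number certificate on one model) →
ChiralThreefolds; otherwise ChiralThreefolds ⇐ DivisorAnchor (HC on crepant resolutions of singular
OG6-varieties, arXiv:2504.13607 —
known) → EquivariantHyperholomorphicTransport (a G-orbit of slope-polystable hyperholomorphic
reflexive sheaves on an anchor X₀ whose ch₃
has full odd-character support deforms along twistor paths to every OG6-type manifold,
arXiv:1805.11574 §-style) → ChiralThreefolds.
EvenCharacterStrings ⇐ FixedK3SpanU8 (e_a[S], S the 16-K3 fixed loci of the 30 pure involutions,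
span e_a H⁸ for all even a ≠ 0) →
LefschetzInversionOG6 (L_h² : e_a H⁴ → e_a H⁸ has an algebraic inverse correspondence: standard
conjecture B for OG6-type in degrees
4 ↔ 8, Charles–Markman style arXiv:1009.0413) → EvenCharacterStrings. InvariantSector ⇐
BeauvilleBogomolovClass (q^∨ algebraic:
c₂(X) = c·q^∨ + G-invariant U₄-part) → WedgeClasses (the V_(1,1,1) Hodge classes for E = Q) →
InvariantSector, the glue being SO(T)-invariant
theory of V_(3) ⊕ V_(1,1,1). k ≤ 3 children each, depth 1.

KILL CRITERIA. A refutation of ChiralThreefolds, EvenCharacterStrings or InvariantSector is a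
projective OG6-type X with a non-algebraic rational
(p,p)-class, i.e. a COUNTEREXAMPLE TO THE HODGE CONJECTURE (and, the classes being
motivated/absolute by arXiv:1904.11320, to standard
conjecture B): close `refuted:<Decl>` and hand the witness to the summit's negative side. Pivots:
(i) CharacterCensus finds a trivial
character among the 240 singlets or the 135 V-copies ⇒ canonical classes migrate into
InvariantSector — re-rank InvariantSector to 2 and
restate the sector split (no statement becomes false); (ii) CharacterCensus confirms that no
involution fixes a fourfold AND a
Voisin-type vanishing "every G-equivariant hyperholomorphic sheaf on a very general OG6 has ch₃ with
zero odd-character component" is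
proved ⇒ ChiralThreefolds has no engine left: route dormant, card re-graded. Mooted if HC(OG6-type)
is proved wholesale elsewhere (e.g.
an extension of arXiv:2504.13607 off the singular-OG6 divisor by Markman-type transport).

NOT DECOMPOSED YET. Deliberately not itemised at open: the E ≠ Q sector (real or complex
multiplication on T(X), rk T ≤ 7: the K3-type exceptional classes in
Sym² T ⊂ H⁴ — a different mechanism, cf. route EvenB2Twistor; Target and InvariantSector carry the E
= Q hypothesis explicitly); the
character table and fixed-locus census of G on OG6 (informal support item CharacterCensus: a finite
computation on the
Mongardi–Rapagnetta–Saccà model, prerequisite for every layer-2 split); the hyper-Kähler layer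
(twistor families, slope-stability,
hyperholomorphic sheaves, trianalytic subvarieties — untyped in Literature;
EquivariantHyperholomorphicTransport stays prose until then);
the identification of the typed frame with the deformation type (FrameOfOG6Type, informal;
definition request IsOfOGradySixType);
Chow-level and Tate-side statements (arXiv:2009.10959) and Kum_n, n ≥ 4 (same template, recorded on
the card, not pursued).

CHEAPEST FALSIFIER. The CHARACTER CENSUS on one model (refuters/grounders first; kit-sized
bookkeeping, no periods): from Floccari's motivic decomposition of the
modular OG6 h(K̃_v) = h(Km(A)^(3)) ⊕ h(Km(A)²)(−1) ⊕ h(Km(A×A))(−1) ⊕ 137 h(Km A)(−2) ⊕ 512 Q(−3)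
(arXiv:2203.16257 Thm 1) and the
(A×A^)[2]-action traced through the MRS construction, compute tr(g^*|H⁴), tr(g^*|H⁶) for the 255
involutions and the fixed loci
(redoing arXiv:1411.0759 Prop 5.7, which contradicts Σ_g χ(X^g) = 256·dim(H*)^G ≥ 256·210: 1920 +
30·384 + 45·48 + 180·16 = 18480 is not
even divisible by 256). KILLS the line's engines if: the 240 LLV-singlets contain G-invariants of
large multiplicity (projectors do not
separate canonical classes) — the typed cruxes stay true-or-HC-false but lose their point; CONFIRMS
the fast lane if some involutions fix
fourfolds (then Floccari's Kum³ proof ports). I could not run it here (no OG6 model in kit; it is a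
pen-and-paper/representation-theory
computation): filed as CharacterCensus. Lookup already done: HC(OG6-type) is NOT in print beyond the
singular-OG6 divisor
(arXiv:2504.13607, 2026) — zbMATH/arXiv-local searches 2026-08-15.

NUMBERS. OG6-type: b₂ = 8, b₄ = 199, b₆ = 1504, χ_top = 1920, no odd cohomology (arXiv:1603.06731);
LLV: H* = V_(3) (210) ⊕ V_(1,1,1) (120 =
28 + 64 + 28 in degrees 4, 6, 8) ⊕ 135 V (135 + 1080 + 135) ⊕ 240 ℝ (degree 6) (arXiv:1906.03432 Thm
52, Lemma 59); canonical Hodge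
classes: 1 + 135 in H⁴, 240 in H⁶, 136 in H⁸. |G| = 256, 255 involutions = 30 pure (fixed locus 16
K3, χ = 384: Props 5.1/5.3) + 225
mixed (Prop 5.7 claims 45 × 2 K3 + 180 × 16 points; Lefschetz needs their χ to average ≥ 179.2; the
card's theta-characteristic table
predicts 105 × 384 + 120 × 256, dim(H*)^G = 330, (H⁴)^G = 64, (H⁶)^G = 184). Kum³ comparison
(arXiv:2308.02267): G = (Z/2)^5, χ(K^g) ∈
{464, 192}, fixed K3^[2]-fourfolds W_τ + 140 points, 240 singlets with no G-invariants, 256 classes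
d_τ,α spanning the 241 canonical
middle classes. Moduli: polarized OG6-type families are 5-dimensional; HC known on the 4-dimensional
singular-OG6 divisors
(arXiv:2504.13607) and the 3-dimensional modular loci (arXiv:2203.16257). Items at open: 9 typed + 2
informal support (≤ 15).

DEFINITION REQUESTS. IsOfOGradySixType (X deformation equivalent, through smooth proper families, to
O'Grady's crepant resolution K̃_v(A,H) of the Albanese
fibre of M_(2v₀)(A,H); topic Literature/AlgebraicGeometry/Hyperkaehler — none of hyper-Kähler
manifold, Beauville–Bogomolov form, LLV
algebra, Aut₀, trianalytic subvariety exists in Literature: `lean search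
'HyperKaehler|IrreducibleSymplectic|OGrady|Beauville' --decl` = 0
hits) — wanted to replace the inline frame and to type FrameOfOG6Type and CharacterCensus. Cite
facts wanted (family hodge): "fact:
Aut₀(OG6-type) ≅ (Z/2)^8" (arXiv:1411.0759 Thm 4.2), "fact: LLV decomposition of OG6-type"
(arXiv:1906.03432 Thm 52), "fact: HC for
crepant resolutions of singular OG6-varieties" (arXiv:2504.13607), "fact: Aut₀ is deformation
invariant" (arXiv:1004.0046 Thm 2.1).

Novelty: Searches (2026-08-15): `lit search "O'Grady six dimensional hyperkähler Hodge conjecture algebraic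
cycles"` (local 9: arXiv:2009.10959,
1904.11320, 2504.13607, 2308.02267, 1002.5011, 2602.19835 …; remote rate-limited except crossref 15
generic); zbMATH: "Hodge conjecture
O'Grady sixfold" (1: arXiv:2210.02948), "O'Grady six algebraic cycles Chow" (0), "OG6 type
hyper-Kähler" (8: arXiv:2204.09582,
1909.07173, 2109.03987, 2009.02120, 2407.07622 …), "O'Grady six dimensional automorphisms" (1:
arXiv:1603.06731), "Lefschetz standard
conjecture hyper-Kähler O'Grady" (0), "hyperholomorphic sheaves O'Grady" (2: arXiv:2211.08970,
arXiv:2504.13607), "motive O'Grady six"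
(2: arXiv:2009.10959, arXiv:2203.16257); `lit frontier HodgeConjecture --since 2021` (30 rows, none
on OG6; arXiv:2501.02315 Kum-type ↔
K3); `lit galaxy search "O'Grady six" / "of OG6 type" / "Hodge conjecture hyperkähler" --star all`
(0 relevant); READ: arXiv:1411.0759
§4–5 (Thm 4.2, Props 5.1/5.3/5.7, Rem 5.9), arXiv:1906.03432 §3.5 (Thm 52, Props 54/56/58, Lemma
59), arXiv:2203.16257 (Thm 1, Cor 2, §5),
arXiv:2308.02267 §1, §2.4–2.5, §6 (Prop 6.1, Lemma 6.4, Prop 6.5), arXiv:2504.13607 abstract + §1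
(Thm 1.3); negatives index (0).
Nearest prior art found: arXiv:2308.02267 (Floccari: HC for ALL projective Kum³-type by exactly this
template — Aut₀-subgroup (Z/2)^5,
invariant part via the associated K3 / quotient Y_K, 240 canonical middle classes via divisors on
fixed fourfolds, Lefschetz trace to
show the singlets have  [refs: 2009.10959, 2210.02948, 2204.09582, 1603.06731, 2211.08970, 2504.13607, 2203.16257, 2501.02315, 1411.0759, 1906.03432, 2308.02267, 1004.0046, 2308.04865]

Barriers (technique_class: hyperkaehler, finite-group-characters, trianalytic): - technique_class: hyperkaehler, finite-group-characters, trianalytic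
- Literature.Barriers.HodgeConjecture.Weil1977_exceptionalHodgeClasses: the 135 + 240 canonical
classes and the V_(1,1,1) wedge classes ARE exceptional (outside the divisor ring); the line never
claims divisor generation — it isolates them by algebraic projectors and routes each sector to a
named engine (fixed loci + Lefschetz inversion; fixed fourfolds or equivariant hyperholomorphic
transport; associated K3^[3] cover).
- Literature.Barriers.HodgeConjecture.Mumford1968_simpleFourfold_exceptionalHodgeClasses: same
answer; moreover the E = Q hypothesis of Target/InvariantSector excludes the CM/RM exceptional
classes in Sym² T, which are conceded (Not decomposed yet).
- Literature.Barriers.HodgeConjecture.Andre1996_hodgeClassesOnAbelianVarieties_motivated: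
consistent, not evaded — OG6 classes are motivated and absolute (arXiv:1904.11320), so the negative
branch of the kill criteria would contradict standard conjecture B; no Galois-conjugation test is
proposed.
- Literature.Barriers.HodgeConjecture.Voisin2002_weilTorus_hodgeClassWithoutSubvarieties: bites on
CARRIERS exactly as Verbitsky's parity does (no effective or coherent-sheaf-free carrier of a pure
singlet class on a very general OG6 is expected); the fallback engine transports SHEAVES of rank ≥ 2
along twistor lines through non-projective members and reads Chern classes at projective endpoints
by GAGA (Deligne2000 §2 (ii)), as in Markman arXiv:1805.115

sub-problem: HodgeConjecture · status: done · opened planner-plancard-HodgeConjecture-HodgeConject-1ea43a5c-0 2026-08-15T13:56:23Z · rev 0 · ledger route-HodgeConjecture-OG6CharacterSectors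
GENERATED by the gate from the ledger (D-0016/17). Provers cite these decls: `theorem foo : Summit.HodgeConjecture.HodgeConjecture.Theses.OG6CharacterSectors.<Decl> := …` in Summits/HodgeConjecture/HodgeConjecture/Theorems/<Name>.lean.
-/

namespace Summit.HodgeConjecture.HodgeConjecture.Theses.OG6CharacterSectors

open scoped BigOperators Topology Manifold Classical MeasureTheory ProbabilityTheory Matrix InnerProductSpace ComplexConjugate ContinuousMap
open Filter Set Function TopologicalSpace MeasureTheory

attribute [summit_statement] _root_.HodgeConjecture

/-- item stmt-HodgeConjecture-9353 · target · rank 0 · open · by planner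
why it might fail: False iff some endomorphism-generic projective OG6 frame carries a non-algebraic Hodge class (motivated and absolute by arXiv:1904.11320, so ¬B would follow); HC(OG6) is known only on the singular-OG6 divisor (arXiv:2504.13607) and modular locus (arXiv:2203.16257).
sources: arXiv:2504.13607, arXiv:2203.16257, arXiv:2308.02267, arXiv:1411.0759, Deligne2000
[target] X: for every OG6 frame (X, g) as in § Thesis which is endomorphism-generic (E = Q),
HodgeConjectureFor 6 X. Equivalent, via the informal support item FrameOfOG6Type, to HC for
endomorphism-generic projective manifolds of OG6 type. -/
@[route_item "route-HodgeConjecture-OG6CharacterSectors"]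
def Target : Prop :=
  ∀ (X : Literature.AlgebraicGeometry.Motives.SchemeOver ℂ) (g : (Fin 8 → ZMod 2) → (X ⟶ X)), (Literature.AlgebraicGeometry.Motives.IsSmoothProjective 6 X ∧ Nonempty (Literature.AlgebraicGeometry.HodgeTheory.HodgeModel 6 X) ∧ (Subsingleton (Literature.AlgebraicGeometry.HodgeTheory.complexBetti X 1) ∧ Subsingleton (Literature.AlgebraicGeometry.HodgeTheory.complexBetti X 3) ∧ Subsingleton (Literature.AlgebraicGeometry.HodgeTheory.complexBetti X 5)) ∧ (Module.finrank ℂ (Literature.AlgebraicGeometry.HodgeTheory.complexBetti X 2) = 8 ∧ Module.finrank ℂ (Literature.AlgebraicGeometry.HodgeTheory.complexBetti X 4) = 199 ∧ Module.finrank ℂ (Literature.AlgebraicGeometry.HodgeTheory.complexBetti X 6) = 1504) ∧ (∃ σ : Literature.AlgebraicGeometry.HodgeTheory.complexBetti X 2, Literature.AlgebraicGeometry.HodgeTheory.IsOfHodgeType 6 X 2 2 0 σ ∧ Literature.AlgebraicTopology.SingularHomology.cupProduct (show 2 + 4 = 6 from rfl) σ (Literature.AlgebraicTopology.SingularHomology.cupProduct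 (show 2 + 2 = 4 from rfl) σ σ) ≠ 0 ∧ ∀ τ : Literature.AlgebraicGeometry.HodgeTheory.complexBetti X 2, Literature.AlgebraicGeometry.HodgeTheory.IsOfHodgeType 6 X 2 2 0 τ → ∃ t : ℂ, τ = t • σ) ∧ (g 0 = CategoryTheory.CategoryStruct.id X ∧ (∀ a b : (Fin 8 → ZMod 2), g (a + b) = CategoryTheory.CategoryStruct.comp (g a) (g b)) ∧ (∀ a : (Fin 8 → ZMod 2), a ≠ 0 → g a ≠ CategoryTheory.CategoryStruct.id X) ∧ (∀ (a : (Fin 8 → ZMod 2)) (c : Literature.AlgebraicGeometry.HodgeTheory.complexBetti X 2), Literature.AlgebraicGeometry.HodgeTheory.complexBetti.map (g a) 2 c = c))) → (∀ ψ : Literature.AlgebraicGeometry.HodgeTheory.complexBetti X 2 →ₗ[ℂ] Literature.AlgebraicGeometry.HodgeTheory.complexBetti X 2, (∀ c, Literature.AlgebraicGeometry.HodgeTheory.IsRationalClass c → Literature.AlgebraicGeometry.HodgeTheory.IsRationalClass (ψ c)) → (∀ (p q : ℕ) (c : Literature.AlgebraicGeometry.HodgeTheory.complexBetti X 2), Literature.AlgebraicGeometry.HodgeTheory.IsOfHodgeType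 6 X 2 p q c → Literature.AlgebraicGeometry.HodgeTheory.IsOfHodgeType 6 X 2 p q (ψ c)) → ∃ r : ℚ, ∀ σ : Literature.AlgebraicGeometry.HodgeTheory.complexBetti X 2, Literature.AlgebraicGeometry.HodgeTheory.IsOfHodgeType 6 X 2 2 0 σ → ψ σ = (r : ℂ) • σ) → Literature.AlgebraicGeometry.HodgeTheory.HodgeConjectureFor 6 X

/-- item stmt-HodgeConjecture-9354 · crux · rank 2 · open · by planner
why it might fail: If no involution in G fixes a fourfold (arXiv:1411.0759 §5 records only K3s and points), no fixed-locus cycle reaches H⁶; these classes are never effective (Verbitsky) nor reachable by L_h, Λ_h, so off the singular-OG6 divisor only untested G-equivariant hyperholomorphic transport remains.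
sources: arXiv:1906.03432, arXiv:1411.0759, arXiv:2308.02267, arXiv:2504.13607, doi:10.1007/bf01928217, arXiv:1805.11574
[crux] CHIRAL MIDDLE PLANES (card C1): for every OG6 frame (X, g), every a ≠ 0 whose character does
NOT occur on H⁴ (∀ c₄, e_a c₄ = 0 — the card's 120 "odd theta characteristics", carrying the 240
canonical LLV-singlets two at a time) and every rational (3,3)-class c ∈ H⁶, the projection e_a c =
2⁻⁸ Σ_b (−1)^(a·b) g_b^* c is algebraic. Equivalently: on every projective OG6-type X there are
algebraic 3-cycles whose e_a-projections span the Hodge classes of e_a H⁶ (chiral threefolds); the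
Poincaré-dual H⁸ clause is the support item OddCharactersOffMiddle. [difficulty: XL] -/
@[route_item "route-HodgeConjecture-OG6CharacterSectors", crux]
def ChiralThreefolds : Prop :=
  ∀ (X : Literature.AlgebraicGeometry.Motives.SchemeOver ℂ) (g : (Fin 8 → ZMod 2) → (X ⟶ X)), (Literature.AlgebraicGeometry.Motives.IsSmoothProjective 6 X ∧ Nonempty (Literature.AlgebraicGeometry.HodgeTheory.HodgeModel 6 X) ∧ (Subsingleton (Literature.AlgebraicGeometry.HodgeTheory.complexBetti X 1) ∧ Subsingleton (Literature.AlgebraicGeometry.HodgeTheory.complexBetti X 3) ∧ Subsingleton (Literature.AlgebraicGeometry.HodgeTheory.complexBetti X 5)) ∧ (Module.finrank ℂ (Literature.AlgebraicGeometry.HodgeTheory.complexBetti X 2) = 8 ∧ Module.finrank ℂ (Literature.AlgebraicGeometry.HodgeTheory.complexBetti X 4) = 199 ∧ Module.finrank ℂ (Literature.AlgebraicGeometry.HodgeTheory.complexBetti X 6) = 1504) ∧ (∃ σ : Literature.AlgebraicGeometry.HodgeTheory.complexBetti X 2, Literature.AlgebraicGeometry.HodgeTheory.IsOfHodgeType 6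 X 2 2 0 σ ∧ Literature.AlgebraicTopology.SingularHomology.cupProduct (show 2 + 4 = 6 from rfl) σ (Literature.AlgebraicTopology.SingularHomology.cupProduct (show 2 + 2 = 4 from rfl) σ σ) ≠ 0 ∧ ∀ τ : Literature.AlgebraicGeometry.HodgeTheory.complexBetti X 2, Literature.AlgebraicGeometry.HodgeTheory.IsOfHodgeType 6 X 2 2 0 τ → ∃ t : ℂ, τ = t • σ) ∧ (g 0 = CategoryTheory.CategoryStruct.id X ∧ (∀ a b : (Fin 8 → ZMod 2), g (a + b) = CategoryTheory.CategoryStruct.comp (g a) (g b)) ∧ (∀ a : (Fin 8 → ZMod 2), a ≠ 0 → g a ≠ CategoryTheory.CategoryStruct.id X) ∧ (∀ (a : (Fin 8 → ZMod 2)) (c : Literature.AlgebraicGeometry.HodgeTheory.complexBetti X 2), Literature.AlgebraicGeometry.HodgeTheory.complexBetti.map (g a) 2 c = c))) → ∀ a : (Fin 8 → ZMod 2), a ≠ 0 → (∀ c₄ : Literature.AlgebraicGeometry.HodgeTheory.complexBetti X (2 * 2), ((1 / 256 : ℂ) • ∑ b : (Fin 8 → ZMod 2), ((-1 : ℂ)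 ^ (∑ i : Fin 8, (a i * b i).val)) • Literature.AlgebraicGeometry.HodgeTheory.complexBetti.map (g b) (2 * 2) c₄) = 0) → ∀ c : Literature.AlgebraicGeometry.HodgeTheory.complexBetti X (2 * 3), Literature.AlgebraicGeometry.HodgeTheory.IsRationalClass c → Literature.AlgebraicGeometry.HodgeTheory.IsOfHodgeType 6 X (2 * 3) 3 3 c → ((1 / 256 : ℂ) • ∑ b : (Fin 8 → ZMod 2), ((-1 : ℂ) ^ (∑ i : Fin 8, (a i * b i).val)) • Literature.AlgebraicGeometry.HodgeTheory.complexBetti.map (g b) (2 * 3) c) ∈ Literature.AlgebraicGeometry.HodgeTheory.algebraicClasses X 3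

/-- item stmt-HodgeConjecture-9355 · crux · rank 3 · open · by planner
why it might fail: Fixed K3 surfaces feed only H⁸; reaching the H⁴ lines needs a Lefschetz inversion (standard conjecture B for OG6-type, open off the modular locus) or fixed fourfolds; and the 16-K3 configurations of the 30 pure involutions may span only the characters of a proper subgroup.
sources: arXiv:1411.0759, arXiv:1009.0413, arXiv:1906.03432, arXiv:2203.16257, arXiv:1004.0046
[crux] EVEN CHARACTER STRINGS (card C2): for every OG6 frame (X, g) and every a ≠ 0 whose character
OCCURS on H⁴ (∃ c₄, e_a c₄ ≠ 0 — the card's 135 non-zero "even theta characteristics", one canonical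
line u_a ∈ H⁴ each, with the V-string u_a·H² ⊂ H⁶ and u_a·h² ∈ H⁸), the e_a-projections of rational
(2,2)-, (3,3)- and (4,4)-classes are algebraic. Intended proof: e_a H⁸ is spanned by e_a[S] for the
fixed K3 surfaces S of the 30 pure involutions (arXiv:1411.0759 Props 5.1, 5.3; fixed loci deform
with X), then invert L_h² (standard conjecture B for OG6-type in degrees 4 ↔ 8) or use fixed
fourfolds if the census finds them; H⁶ follows by cup with divisors. [difficulty: L] -/
@[route_item "route-HodgeConjecture-OG6CharacterSectors", crux]
def EvenCharacterStrings : Prop :=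
  ∀ (X : Literature.AlgebraicGeometry.Motives.SchemeOver ℂ) (g : (Fin 8 → ZMod 2) → (X ⟶ X)), (Literature.AlgebraicGeometry.Motives.IsSmoothProjective 6 X ∧ Nonempty (Literature.AlgebraicGeometry.HodgeTheory.HodgeModel 6 X) ∧ (Subsingleton (Literature.AlgebraicGeometry.HodgeTheory.complexBetti X 1) ∧ Subsingleton (Literature.AlgebraicGeometry.HodgeTheory.complexBetti X 3) ∧ Subsingleton (Literature.AlgebraicGeometry.HodgeTheory.complexBetti X 5)) ∧ (Module.finrank ℂ (Literature.AlgebraicGeometry.HodgeTheory.complexBetti X 2) = 8 ∧ Module.finrank ℂ (Literature.AlgebraicGeometry.HodgeTheory.complexBetti X 4) = 199 ∧ Module.finrank ℂ (Literature.AlgebraicGeometry.HodgeTheory.complexBetti X 6) = 1504) ∧ (∃ σ : Literature.AlgebraicGeometry.HodgeTheory.complexBetti X 2, Literature.AlgebraicGeometry.HodgeTheory.IsOfHodgeType 6 X 2 2 0 σ ∧ Literature.AlgebraicTopology.SingularHomology.cupProduct (show 2 + 4 = 6 from rfl) σ (Literature.AlgebraicTopology.SingularHomology.cupProduct (show 2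 + 2 = 4 from rfl) σ σ) ≠ 0 ∧ ∀ τ : Literature.AlgebraicGeometry.HodgeTheory.complexBetti X 2, Literature.AlgebraicGeometry.HodgeTheory.IsOfHodgeType 6 X 2 2 0 τ → ∃ t : ℂ, τ = t • σ) ∧ (g 0 = CategoryTheory.CategoryStruct.id X ∧ (∀ a b : (Fin 8 → ZMod 2), g (a + b) = CategoryTheory.CategoryStruct.comp (g a) (g b)) ∧ (∀ a : (Fin 8 → ZMod 2), a ≠ 0 → g a ≠ CategoryTheory.CategoryStruct.id X) ∧ (∀ (a : (Fin 8 → ZMod 2)) (c : Literature.AlgebraicGeometry.HodgeTheory.complexBetti X 2), Literature.AlgebraicGeometry.HodgeTheory.complexBetti.map (g a) 2 c = c))) → ∀ a : (Fin 8 → ZMod 2), a ≠ 0 → (∃ c₄ : Literature.AlgebraicGeometry.HodgeTheory.complexBetti X (2 * 2), ((1 / 256 : ℂ) • ∑ b : (Fin 8 → ZMod 2), ((-1 : ℂ) ^ (∑ i : Fin 8, (a i * b i).val)) • Literature.AlgebraicGeometry.HodgeTheory.complexBetti.map (g b) (2 * 2) c₄) ≠ 0) → (∀ c : Literature.AlgebraicGeometry.HodgeTheory.complexBetti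 X (2 * 2), Literature.AlgebraicGeometry.HodgeTheory.IsRationalClass c → Literature.AlgebraicGeometry.HodgeTheory.IsOfHodgeType 6 X (2 * 2) 2 2 c → ((1 / 256 : ℂ) • ∑ b : (Fin 8 → ZMod 2), ((-1 : ℂ) ^ (∑ i : Fin 8, (a i * b i).val)) • Literature.AlgebraicGeometry.HodgeTheory.complexBetti.map (g b) (2 * 2) c) ∈ Literature.AlgebraicGeometry.HodgeTheory.algebraicClasses X 2) ∧ (∀ c : Literature.AlgebraicGeometry.HodgeTheory.complexBetti X (2 * 3), Literature.AlgebraicGeometry.HodgeTheory.IsRationalClass c → Literature.AlgebraicGeometry.HodgeTheory.IsOfHodgeType 6 X (2 * 3) 3 3 c → ((1 / 256 : ℂ) • ∑ b : (Fin 8 → ZMod 2), ((-1 : ℂ) ^ (∑ i : Fin 8, (a i * b i).val)) • Literature.AlgebraicGeometry.HodgeTheory.complexBetti.map (g b) (2 * 3) c) ∈ Literature.AlgebraicGeometry.HodgeTheory.algebraicClasses X 3) ∧ (∀ c : Literature.AlgebraicGeometry.HodgeTheory.complexBetti X (2 * 4), Literature.AlgebraicGeometry.HodgeTheory.IsRationalClass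 c → Literature.AlgebraicGeometry.HodgeTheory.IsOfHodgeType 6 X (2 * 4) 4 4 c → ((1 / 256 : ℂ) • ∑ b : (Fin 8 → ZMod 2), ((-1 : ℂ) ^ (∑ i : Fin 8, (a i * b i).val)) • Literature.AlgebraicGeometry.HodgeTheory.complexBetti.map (g b) (2 * 4) c) ∈ Literature.AlgebraicGeometry.HodgeTheory.algebraicClasses X 4)

/-- item stmt-HodgeConjecture-9356 · crux · rank 4 · open · by planner
why it might fail: If the character table puts a trivial character inside the 135 V-copies or the 240 singlets this sector contains canonical exceptional classes; even otherwise the V_(1,1,1) classes (h∧u₊∧u₋, d∧d′, det T for ρ = 5 — killed by every L_d and Λ_d) have no known cycles off the singular-OG6 divisor.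
sources: arXiv:1906.03432, arXiv:2203.16257, arXiv:2504.13607, arXiv:2210.02948, arXiv:2308.02267
[crux] INVARIANT SECTOR (card "A₂-part" made honest): for every endomorphism-generic OG6 frame (X,
g) (E = Q) and every rational (p,p)-class c, the G-average e₀ c = 2⁻⁸ Σ_b g_b^* c is algebraic. By
the card's character table (H*)^G = V_(3) ⊕ V_(1,1,1): for E = Q its Hodge classes are polynomials
in NS(X) and the Beauville–Bogomolov class q^∨ (= c₂(X)/c if c₂ has no U₄-component) plus the
V_(1,1,1)-classes h∧u₊∧u₋ (ρ ≥ 1), d∧d′ ∈ Λ²NS ⊂ H⁴, H⁸ (ρ ≥ 2), Λ³NS (ρ ≥ 3) and det T ∈ Λ³T ⊂ H⁶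
(ρ = 5). Natural engines: the associated K3^[3]-type double cover on the singular-OG6 divisor
(arXiv:2504.13607, arXiv:1603.06731), quotients X/H for H ≤ G (Floccari's Y_K for Kum³,
arXiv:2210.02948), deformation of these classes from the modular locus (arXiv:2203.16257).
[difficulty: L] -/
@[route_item "route-HodgeConjecture-OG6CharacterSectors", crux]
def InvariantSector : Prop :=
  ∀ (X : Literature.AlgebraicGeometry.Motives.SchemeOver ℂ) (g : (Fin 8 → ZMod 2) → (X ⟶ X)), (Literature.AlgebraicGeometry.Motives.IsSmoothProjective 6 X ∧ Nonempty (Literature.AlgebraicGeometry.HodgeTheory.HodgeModel 6 X) ∧ (Subsingleton (Literature.AlgebraicGeometry.HodgeTheory.complexBetti X 1) ∧ Subsingleton (Literature.AlgebraicGeometry.HodgeTheory.complexBetti X 3) ∧ Subsingleton (Literature.AlgebraicGeometry.HodgeTheory.complexBetti X 5)) ∧ (Module.finrank ℂ (Literature.AlgebraicGeometry.HodgeTheory.complexBetti X 2) = 8 ∧ Module.finrank ℂ (Literature.AlgebraicGeometry.HodgeTheory.complexBetti X 4) = 199 ∧ Module.finrank ℂ (Literature.AlgebraicGeometry.HodgeTheory.complexBetti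 X 6) = 1504) ∧ (∃ σ : Literature.AlgebraicGeometry.HodgeTheory.complexBetti X 2, Literature.AlgebraicGeometry.HodgeTheory.IsOfHodgeType 6 X 2 2 0 σ ∧ Literature.AlgebraicTopology.SingularHomology.cupProduct (show 2 + 4 = 6 from rfl) σ (Literature.AlgebraicTopology.SingularHomology.cupProduct (show 2 + 2 = 4 from rfl) σ σ) ≠ 0 ∧ ∀ τ : Literature.AlgebraicGeometry.HodgeTheory.complexBetti X 2, Literature.AlgebraicGeometry.HodgeTheory.IsOfHodgeType 6 X 2 2 0 τ → ∃ t : ℂ, τ = t • σ) ∧ (g 0 = CategoryTheory.CategoryStruct.id X ∧ (∀ a b : (Fin 8 → ZMod 2), g (a + b) = CategoryTheory.CategoryStruct.comp (g a) (g b)) ∧ (∀ a : (Fin 8 → ZMod 2), a ≠ 0 → g a ≠ CategoryTheory.CategoryStruct.id X) ∧ (∀ (a : (Fin 8 → ZMod 2)) (c : Literature.AlgebraicGeometry.HodgeTheory.complexBetti X 2), Literature.AlgebraicGeometry.HodgeTheory.complexBetti.map (g a) 2 c = c))) → (∀ ψ : Literature.AlgebraicGeometry.HodgeTheory.complexBetti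 X 2 →ₗ[ℂ] Literature.AlgebraicGeometry.HodgeTheory.complexBetti X 2, (∀ c, Literature.AlgebraicGeometry.HodgeTheory.IsRationalClass c → Literature.AlgebraicGeometry.HodgeTheory.IsRationalClass (ψ c)) → (∀ (p q : ℕ) (c : Literature.AlgebraicGeometry.HodgeTheory.complexBetti X 2), Literature.AlgebraicGeometry.HodgeTheory.IsOfHodgeType 6 X 2 p q c → Literature.AlgebraicGeometry.HodgeTheory.IsOfHodgeType 6 X 2 p q (ψ c)) → ∃ r : ℚ, ∀ σ : Literature.AlgebraicGeometry.HodgeTheory.complexBetti X 2, Literature.AlgebraicGeometry.HodgeTheory.IsOfHodgeType 6 X 2 2 0 σ → ψ σ = (r : ℂ) • σ) → ∀ (p : ℕ) (c : Literature.AlgebraicGeometry.HodgeTheory.complexBetti X (2 * p)), Literature.AlgebraicGeometry.HodgeTheory.IsRationalClass c → Literature.AlgebraicGeometry.HodgeTheory.IsOfHodgeType 6 X (2 * p) p p c → ((1 / 256 : ℂ) • ∑ b : (Fin 8 → ZMod 2), ((-1 : ℂ) ^ (∑ i : Fin 8, ((0 : (Fin 8 → ZMod 2)) i * b i).val)) •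 Literature.AlgebraicGeometry.HodgeTheory.complexBetti.map (g b) (2 * p) c) ∈ Literature.AlgebraicGeometry.HodgeTheory.algebraicClasses X p

/-- item stmt-HodgeConjecture-9357 · support · rank 9 · closed · proved by Summit.HodgeConjecture.HodgeConjecture.Theorems.og6CharacterSectors_outerDegrees_proof @ 5ebfd1e2281b (prover) · by planner
sources: arXiv:1411.0759, Deligne2000
[support] BOOKKEEPING: for an OG6 frame, p ∉ {2,3,4} and a ≠ 0, the e_a-projection of a rational
(p,p)-class in H^(2p) is algebraic — indeed it vanishes: H⁰ and H² are G-trivial by hypothesis (and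
algebraicClasses X 0 = ⊤ is proved), H¹⁰, H¹² by hard Lefschetz with a G-invariant ample class /
Poincaré duality and naturality of cup product (`cupProduct_map`, proved), H^(2p) = 0 for p ≥ 7
(cohomological dimension of the 12-manifold X(ℂ)); needs the named facts hard Lefschetz / top-degree
vanishing for X. [difficulty: provable-now] -/
@[route_item "route-HodgeConjecture-OG6CharacterSectors", crux]
def OuterDegrees : Prop :=
  ∀ (X : Literature.AlgebraicGeometry.Motives.SchemeOver ℂ) (g : (Fin 8 → ZMod 2) → (X ⟶ X)), (Literature.AlgebraicGeometry.Motives.IsSmoothProjective 6 X ∧ Nonempty (Literature.AlgebraicGeometry.HodgeTheory.HodgeModel 6 X) ∧ (Subsingleton (Literature.AlgebraicGeometry.HodgeTheory.complexBetti X 1) ∧ Subsingleton (Literature.AlgebraicGeometry.HodgeTheory.complexBetti X 3) ∧ Subsingleton (Literature.AlgebraicGeometry.HodgeTheory.complexBetti X 5)) ∧ (Module.finrank ℂ (Literature.AlgebraicGeometry.HodgeTheory.complexBetti X 2) = 8 ∧ Module.finrank ℂ (Literature.AlgebraicGeometry.HodgeTheory.complexBetti X 4) = 199 ∧ Module.finrank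 ℂ (Literature.AlgebraicGeometry.HodgeTheory.complexBetti X 6) = 1504) ∧ (∃ σ : Literature.AlgebraicGeometry.HodgeTheory.complexBetti X 2, Literature.AlgebraicGeometry.HodgeTheory.IsOfHodgeType 6 X 2 2 0 σ ∧ Literature.AlgebraicTopology.SingularHomology.cupProduct (show 2 + 4 = 6 from rfl) σ (Literature.AlgebraicTopology.SingularHomology.cupProduct (show 2 + 2 = 4 from rfl) σ σ) ≠ 0 ∧ ∀ τ : Literature.AlgebraicGeometry.HodgeTheory.complexBetti X 2, Literature.AlgebraicGeometry.HodgeTheory.IsOfHodgeType 6 X 2 2 0 τ → ∃ t : ℂ, τ = t • σ) ∧ (g 0 = CategoryTheory.CategoryStruct.id X ∧ (∀ a b : (Fin 8 → ZMod 2), g (a + b) = CategoryTheory.CategoryStruct.comp (g a) (g b)) ∧ (∀ a : (Fin 8 → ZMod 2), a ≠ 0 → g a ≠ CategoryTheory.CategoryStruct.id X) ∧ (∀ (a : (Fin 8 → ZMod 2)) (c : Literature.AlgebraicGeometry.HodgeTheory.complexBetti X 2), Literature.AlgebraicGeometry.HodgeTheory.complexBetti.map (g a) 2 c = c))) → ∀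 p : ℕ, p ≠ 2 → p ≠ 3 → p ≠ 4 → ∀ a : (Fin 8 → ZMod 2), a ≠ 0 → ∀ c : Literature.AlgebraicGeometry.HodgeTheory.complexBetti X (2 * p), Literature.AlgebraicGeometry.HodgeTheory.IsRationalClass c → Literature.AlgebraicGeometry.HodgeTheory.IsOfHodgeType 6 X (2 * p) p p c → ((1 / 256 : ℂ) • ∑ b : (Fin 8 → ZMod 2), ((-1 : ℂ) ^ (∑ i : Fin 8, (a i * b i).val)) • Literature.AlgebraicGeometry.HodgeTheory.complexBetti.map (g b) (2 * p) c) ∈ Literature.AlgebraicGeometry.HodgeTheory.algebraicClasses X p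

/-- item stmt-HodgeConjecture-9358 · support · rank 9 · closed · proved by Summit.HodgeConjecture.HodgeConjecture.Theorems.og6CharacterSectors_fourierInversion_proof @ eb57240aebda (prover) · by planner
sources: arXiv:1411.0759
[support] CHARACTER ORTHOGONALITY: for an OG6 frame, Σ_a e_a c = c on every H^k — from g 0 = 𝟙,
`complexBetti.map_id` (proved) and Σ_a (−1)^(a·b) = 256·[b = 0] on (Fin 8 → ZMod 2) (factorise over
coordinates). Pure algebra. [difficulty: provable-now] -/
@[route_item "route-HodgeConjecture-OG6CharacterSectors", crux]
def FourierInversion : Prop :=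
  ∀ (X : Literature.AlgebraicGeometry.Motives.SchemeOver ℂ) (g : (Fin 8 → ZMod 2) → (X ⟶ X)), (Literature.AlgebraicGeometry.Motives.IsSmoothProjective 6 X ∧ Nonempty (Literature.AlgebraicGeometry.HodgeTheory.HodgeModel 6 X) ∧ (Subsingleton (Literature.AlgebraicGeometry.HodgeTheory.complexBetti X 1) ∧ Subsingleton (Literature.AlgebraicGeometry.HodgeTheory.complexBetti X 3) ∧ Subsingleton (Literature.AlgebraicGeometry.HodgeTheory.complexBetti X 5)) ∧ (Module.finrank ℂ (Literature.AlgebraicGeometry.HodgeTheory.complexBetti X 2) = 8 ∧ Module.finrank ℂ (Literature.AlgebraicGeometry.HodgeTheory.complexBetti X 4) = 199 ∧ Module.finrank ℂ (Literature.AlgebraicGeometry.HodgeTheory.complexBetti X 6) = 1504) ∧ (∃ σ : Literature.AlgebraicGeometry.HodgeTheory.complexBetti X 2, Literature.AlgebraicGeometry.HodgeTheory.IsOfHodgeType 6 X 2 2 0 σ ∧ Literature.AlgebraicTopology.SingularHomology.cupProduct (show 2 + 4 = 6 from rfl) σ (Literature.AlgebraicTopology.SingularHomology.cupProduct (show 2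 + 2 = 4 from rfl) σ σ) ≠ 0 ∧ ∀ τ : Literature.AlgebraicGeometry.HodgeTheory.complexBetti X 2, Literature.AlgebraicGeometry.HodgeTheory.IsOfHodgeType 6 X 2 2 0 τ → ∃ t : ℂ, τ = t • σ) ∧ (g 0 = CategoryTheory.CategoryStruct.id X ∧ (∀ a b : (Fin 8 → ZMod 2), g (a + b) = CategoryTheory.CategoryStruct.comp (g a) (g b)) ∧ (∀ a : (Fin 8 → ZMod 2), a ≠ 0 → g a ≠ CategoryTheory.CategoryStruct.id X) ∧ (∀ (a : (Fin 8 → ZMod 2)) (c : Literature.AlgebraicGeometry.HodgeTheory.complexBetti X 2), Literature.AlgebraicGeometry.HodgeTheory.complexBetti.map (g a) 2 c = c))) → ∀ (k : ℕ) (c : Literature.AlgebraicGeometry.HodgeTheory.complexBetti X k), ∑ a : (Fin 8 → ZMod 2), ((1 / 256 : ℂ) • ∑ b : (Fin 8 → ZMod 2), ((-1 : ℂ) ^ (∑ i : Fin 8, (a i * b i).val)) • Literature.AlgebraicGeometry.HodgeTheory.complexBetti.map (g b) k c) = c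

/-- item stmt-HodgeConjecture-9359 · support · rank 9 · closed · proved by Summit.HodgeConjecture.HodgeConjecture.Theorems.og6CharacterSectors_oddCharactersOffMiddle_proof (prover) · by planner
sources: arXiv:1411.0759, Deligne2000
[support] DUALITY BOOKKEEPING: for an OG6 frame, a ≠ 0 whose character does not occur on H⁴, and a
rational (4,4)-class c ∈ H⁸, e_a c is algebraic — indeed e_a annihilates H⁸, because H⁸ ≅ (H⁴)^∨
G-equivariantly (Poincaré duality; automorphisms have degree 1) and the characters of an elementary
abelian 2-group are self-dual; needs the named Poincaré-duality facts for X(ℂ) (or hard Lefschetz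
with a G-invariant ample class plus `cupProduct_map`). [difficulty: provable-now] -/
@[route_item "route-HodgeConjecture-OG6CharacterSectors", crux]
def OddCharactersOffMiddle : Prop :=
  ∀ (X : Literature.AlgebraicGeometry.Motives.SchemeOver ℂ) (g : (Fin 8 → ZMod 2) → (X ⟶ X)), (Literature.AlgebraicGeometry.Motives.IsSmoothProjective 6 X ∧ Nonempty (Literature.AlgebraicGeometry.HodgeTheory.HodgeModel 6 X) ∧ (Subsingleton (Literature.AlgebraicGeometry.HodgeTheory.complexBetti X 1) ∧ Subsingleton (Literature.AlgebraicGeometry.HodgeTheory.complexBetti X 3) ∧ Subsingleton (Literature.AlgebraicGeometry.HodgeTheory.complexBetti X 5)) ∧ (Module.finrank ℂ (Literature.AlgebraicGeometry.HodgeTheory.complexBetti X 2) = 8 ∧ Module.finrank ℂ (Literature.AlgebraicGeometry.HodgeTheory.complexBetti X 4) = 199 ∧ Module.finrank ℂ (Literature.AlgebraicGeometry.HodgeTheory.complexBetti X 6) = 1504) ∧ (∃ σ : Literature.AlgebraicGeometry.HodgeTheory.complexBetti X 2, Literature.AlgebraicGeometry.HodgeTheory.IsOfHodgeType 6 X 2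 2 0 σ ∧ Literature.AlgebraicTopology.SingularHomology.cupProduct (show 2 + 4 = 6 from rfl) σ (Literature.AlgebraicTopology.SingularHomology.cupProduct (show 2 + 2 = 4 from rfl) σ σ) ≠ 0 ∧ ∀ τ : Literature.AlgebraicGeometry.HodgeTheory.complexBetti X 2, Literature.AlgebraicGeometry.HodgeTheory.IsOfHodgeType 6 X 2 2 0 τ → ∃ t : ℂ, τ = t • σ) ∧ (g 0 = CategoryTheory.CategoryStruct.id X ∧ (∀ a b : (Fin 8 → ZMod 2), g (a + b) = CategoryTheory.CategoryStruct.comp (g a) (g b)) ∧ (∀ a : (Fin 8 → ZMod 2), a ≠ 0 → g a ≠ CategoryTheory.CategoryStruct.id X) ∧ (∀ (a : (Fin 8 → ZMod 2)) (c : Literature.AlgebraicGeometry.HodgeTheory.complexBetti X 2), Literature.AlgebraicGeometry.HodgeTheory.complexBetti.map (g a) 2 c = c))) → ∀ a : (Fin 8 → ZMod 2), a ≠ 0 → (∀ c₄ : Literature.AlgebraicGeometry.HodgeTheory.complexBetti X (2 * 2), ((1 / 256 : ℂ) • ∑ b : (Fin 8 → ZMod 2), ((-1 : ℂ) ^ (∑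 i : Fin 8, (a i * b i).val)) • Literature.AlgebraicGeometry.HodgeTheory.complexBetti.map (g b) (2 * 2) c₄) = 0) → ∀ c : Literature.AlgebraicGeometry.HodgeTheory.complexBetti X (2 * 4), Literature.AlgebraicGeometry.HodgeTheory.IsRationalClass c → Literature.AlgebraicGeometry.HodgeTheory.IsOfHodgeType 6 X (2 * 4) 4 4 c → ((1 / 256 : ℂ) • ∑ b : (Fin 8 → ZMod 2), ((-1 : ℂ) ^ (∑ i : Fin 8, (a i * b i).val)) • Literature.AlgebraicGeometry.HodgeTheory.complexBetti.map (g b) (2 * 4) c) ∈ Literature.AlgebraicGeometry.HodgeTheory.algebraicClasses X 4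

/-- item stmt-HodgeConjecture-9360 · support · rank 9 · open · by planner
sources: Deligne2000
[support] NOT CLAIMED BY THIS ROUTE — the remainder of the summit given X: `Target →
HodgeConjecture`, i.e. the Hodge conjecture for every smooth projective complex variety that is not
an endomorphism-generic OG6 frame (all other dimensions and deformation types, the E ≠ Q OG6
manifolds, abelian varieties, hypersurfaces, …), granted HC on the OG6 sector. Present only so that
the deciding theorem `closes` and the Assembly reach `HodgeConjecture` (D-0027 §2.1); it is the
frame statement "X → Statement" of the planner brief. Any route proving the summit outright
supersedes it. Do not staff. [difficulty: open-problem] -/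
@[route_item "route-HodgeConjecture-OG6CharacterSectors", crux]
def SummitBeyondOG6Frames : Prop :=
  Summit.HodgeConjecture.HodgeConjecture.Theses.OG6CharacterSectors.Target → HodgeConjecture

-- item stmt-HodgeConjecture-9625 · support · rank 9 · open · by planner — informal only, no Lean statement yet:
--   [support] CHARACTER CENSUS OF OG6 (card S1; the route's cheapest falsifier and the prerequisite of
--   every layer-2 split). For a manifold X of OG6 type with G = Aut_0(X) = ker(Aut X -> O(H^2)) =
--   (Z/2)^8 (arXiv:1411.0759 Thm 4.2), determine (a) the G-character of H^4, H^6, H^8 (multiplicity of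
--   each of the 256 characters, and which LLV summands of arXiv:1906.03432 Thm 52 — V_(3), V_(1,1,1),
--   the 135-dim multiplicity space of V, the 240-dim multiplicity space of the trivial module — they
--   occupy) and (b) the fixed locus X^g of each of the 255 involutions (dimensions and types of
--   components). Both are

-- item stmt-HodgeConjecture-9626 · support · rank 9 · open · by planner — informal only, no Lean statement yet:
--   [support] FRAME OF OG6 TYPE (bridge from the typed Target to the deformation type; informal until
--   IsOfOGradySixType is defined — definition request filed). Every projective manifold X of OG6 type
--   (deformation equivalent to O'Grady's crepant resolution K~_v(A,H)) satisfies the route's typed frame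
--   with g an isomorphism (Z/2)^8 -> Aut_0(X): X is smooth projective of dimension 6 with a Hodge model
--   (GAGA/Hodge theory); b_1 = b_3 = b_5 = 0, b_2 = 8, b_4 = 199, b_6 = 1504 (arXiv:1603.06731,
--   Rapagnetta Math. Z. 256 (2007)); H^{2,0} = C sigma with sigma^3 != 0 in H^6(X(C);C) (irreducible
--   holomorphic sy

/-- item stmt-HodgeConjecture-9361 · assembly · rank 1 · closed · proved by Summit.HodgeConjecture.HodgeConjecture.Theorems.og6CharacterSectors_assembly_proof @ 8d0be1c2d872 (prover) · by planner
sources: arXiv:2308.02267, Deligne2000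
[assembly] ChiralThreefolds → EvenCharacterStrings → InvariantSector → OuterDegrees →
OddCharactersOffMiddle → FourierInversion → SummitBeyondOG6Frames → HodgeConjecture. -/
@[route_item "route-HodgeConjecture-OG6CharacterSectors"]
def Assembly : Prop :=
  ChiralThreefolds → EvenCharacterStrings → InvariantSector → OuterDegrees → OddCharactersOffMiddle → FourierInversion → SummitBeyondOG6Frames → HodgeConjecture

/-! D-0027 §2.1 — DECIDING THEOREM (planner-authored via `route open/edit --closes-file`; by planner-plancard-HodgeConjecture-HodgeConject-1ea43a5c-0 2026-08-15T13:56:24Z):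
its hypotheses are this route's items and its conclusion the sub-problem Statement (glue_lint), and it elaborates with this file. -/

/-- DECIDING THEOREM (D-0027 §2.1). Pure logic: for an endomorphism-generic OG6 frame `(X, g)` and a
rational `(p,p)`-class `c`, `FourierInversion` rewrites `c = Σ_a e_a c`; the `a = 0` term is
`InvariantSector`; for `a ≠ 0` split on whether the character of `a` occurs on `H⁴` and on
`p ∈ {2,3,4}`: `EvenCharacterStrings` (occurs), `ChiralThreefolds` (`p = 3`) /
`OddCharactersOffMiddle` (`p = 4`) / zero (`p = 2`) (does not occur), `OuterDegrees` otherwise —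
this is X = `Target` (HC for endomorphism-generic OG6 frames); the NOT-claimed remainder
`SummitBeyondOG6Frames : Target → HodgeConjecture` then yields the summit statement. -/
@[closes "route-HodgeConjecture-OG6CharacterSectors"] theorem closes : ChiralThreefolds → EvenCharacterStrings → InvariantSector → OuterDegrees →
    OddCharactersOffMiddle → FourierInversion → SummitBeyondOG6Frames → HodgeConjecture := by
  intro hT hE hI hO hM hF hS
  refine hS ?_
  intro X g hFr hEQ
  refine ⟨hFr.2.1, fun p c hr hh => ?_⟩
  have key := hF X g hFr (2 * p) c
  rw [← key]
  refine Submodule.sum_mem _ (fun a _ => ?_)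
  by_cases ha : a = 0
  · subst ha
    exact hI X g hFr hEQ p c hr hh
  · by_cases hp2 : p = 2
    · subst hp2
      by_cases hodd : ∀ c₄ : Literature.AlgebraicGeometry.HodgeTheory.complexBetti X (2 * 2), ((1 / 256 : ℂ) • ∑ b : (Fin 8 → ZMod 2), ((-1 : ℂ) ^ (∑ i : Fin 8, (a i * b i).val)) • Literature.AlgebraicGeometry.HodgeTheory.complexBetti.map (g b) (2 * 2) c₄) = 0
      · rw [hodd c]; exact Submodule.zero_mem _
      · push Not at hodd
        exact (hE X g hFr a ha hodd).1 c hr hh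
    by_cases hp3 : p = 3
    · subst hp3
      by_cases hodd : ∀ c₄ : Literature.AlgebraicGeometry.HodgeTheory.complexBetti X (2 * 2), ((1 / 256 : ℂ) • ∑ b : (Fin 8 → ZMod 2), ((-1 : ℂ) ^ (∑ i : Fin 8, (a i * b i).val)) • Literature.AlgebraicGeometry.HodgeTheory.complexBetti.map (g b) (2 * 2) c₄) = 0
      · exact hT X g hFr a ha hodd c hr hh
      · push Not at hodd
        exact (hE X g hFr a ha hodd).2.1 c hr hh
    by_cases hp4 : p = 4
    · subst hp4
      by_cases hodd : ∀ c₄ : Literature.AlgebraicGeometry.HodgeTheory.complexBetti X (2 * 2), ((1 / 256 : ℂ) • ∑ b : (Fin 8 → ZMod 2), ((-1 : ℂ) ^ (∑ i : Fin 8, (a i * b i).val)) • Literature.AlgebraicGeometry.HodgeTheory.complexBetti.map (g b) (2 * 2) c₄) = 0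
      · exact hM X g hFr a ha hodd c hr hh
      · push Not at hodd
        exact (hE X g hFr a ha hodd).2.2 c hr hh
    exact hO X g hFr p hp2 hp3 hp4 a ha c hr hh

end Summit.HodgeConjecture.HodgeConjecture.Theses.OG6CharacterSectors
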